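import Literature.AlgebraicGeometry.AbelianSchemes.AbelianSchemeSymplecticLevel                           -- ★ `LevelStructure.SymplecticLift`, `typeFormMod`
import Literature.AlgebraicGeometry.AbelianSchemes.PolarizationTypeLocallyConstant                     -- ★ `Polarization.hasType_of_exists_mulHom_at` (constancy on a preconnected ℚ-base)
import Literature.AlgebraicGeometry.Motives.AbelianVarietyPolarizationTypeAnalytic                       -- ★ `Polarization.mem_kerPointsAt_iff_mem_KTheta`
import Literature.AlgebraicGeometry.AbelianSchemes.PolarizationKernelSubsetKTheta                         -- ★ `Polarization.finite_kerPointsAt`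
import Literature.AlgebraicGeometry.Motives.AbelianVarietyWeilPairingPerfectOfCoprime                    -- ★ Kummer hypotheses of Lang VII §2 Prop. 4 (`isIsogeny_zsmul_id_holds`, …)
import HarnessLib

/-!
# `HasType δ` from a SYMPLECTIC LIFT at ONE geometric point (the type clause by Lang VII §2 Prop. 4 and the radical of `E_δ` mod `M`)

Topic `AlgebraicGeometry/AbelianSchemes`; THEOREMS ONLY (no definition, no named fact, no instance, no notation, no `sorry`).  Cell `hodgecm-mathlib`,
FLOOR 0, P6 «MOD programme» (crux hLiu418 = stmt-HodgeConjecture-24832, `--supports`, count-neutral); line L4, (S8) sheet-line closer, road (γ′) «Serre tensor over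
`X`, classified», organ **(N3) TYPE-m** (LA4-plan (g2) BOOK v3 2026-09-02T08:48:23Z; consumer: the `hT` binder of ★ `exists_serreTwist_moduliTuple_of_isCMField_rowA`,
LA7-p01 (g3)) — the MARKING-ROAD twin of ★ p849981 `isSymplecticLiftable_of_markedComplexFibre[_comp]` for the TYPE clause, replacing the dead coprime engine (e).

THE MATHEMATICS ([MumfordFogartyKirwan1994] App. 7A; [Lan2013PELCompactifications] §1.3.6 Lemma 1.3.6.5; [Lang1983AbelianVarieties] VII §2 Prop. 4; [MumfordAV1970]
§20, §23).  At a geometric point `s` (`Ω = Ω̄`, characteristic `0`) with `λ̄_s = Λ(𝒪(Θ))` and a SYMPLECTIC LIFT `Λ` for `(Θ, δ)` (★ `LevelStructure.SymplecticLift`: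
`lift_M : (ℤ∕M)^{2g} ⥲ A_s[M](Ω)`, `ē^Θ_M(lift x, lift y) = ζ_M^{E_δ(x,y)}`): `ker λ̄_s(Ω) = K(Θ)(Ω)` (★ `mem_kerPointsAt_iff_mem_KTheta`) is finite (★ `finite_kerPointsAt`),
of exponent `k`; at `M := N·k·∏δᵢ`, `Q ∈ K(Θ) ⇔ Q = lift_M y` with `∀ P ∈ A[M], ē^Θ_M(P, Q) = 1` (⇐ Lang VII §2 Prop. 4; ⇒ `D_Q ∼ 0`) `⇔ y ∈ rad_M(E_δ) =
{y | δᵢ y_{inl i} = δᵢ y_{inr i} = 0} ≅ (∏ ℤ∕δᵢ)²` (§1) — the `δ`-clause AT `s` (§2); over a preconnected base with all `m > 0` invertible it holds everywhere (★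
`hasType_of_exists_mulHom_at`) (§3); at a complex point the lift is BUILT from an adelic marking with its readings (★ (b) `exists_symplecticLift_of_levelReading`), and the
readings transport through a cover `c` exactly as in ★ p849981 (§3, the zip).

* §0 `AbelianVariety.mem_KTheta_of_forall_weilPairingLevel_eq_one` (Lang VII §2 Prop. 4 over `Ω = Ω̄`, Kummer hypotheses discharged), `AbelianVariety.weilPairingLevel_eq_one_of_mem_KTheta`.
* §1 `TypeKernel.forall_typeFormMod_eq_zero_iff` (the radical of `E_δ` mod `M`), `TypeKernel.exists_mulHom_range_eq_typeFormMod_radical` (`(∏ ℤ∕δᵢ)² ≅ rad_M(E_δ)`).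
* §2 **`Polarization.exists_mulHom_range_eq_kerPointsAt_of_symplecticLift`** — the `δ`-clause at ONE geometric point from a symplectic lift.
* §3 **`Polarization.hasType_of_symplecticLift`** (THE HEAD; the marked-fibre heads `SiegelAdelicMarking.hasType_of_markedComplexFibre[_comp]` live in the sequel
  `ModuliOfAbelianVarieties/HasTypeOfMarkedFibre.lean`).
Budgets: default heartbeats.

References: [MumfordFogartyKirwan1994] D. Mumford, J. Fogarty, F. Kirwan, *Geometric Invariant Theory* (3rd ed. 1994), App. 7A pp. 234–235, Ch. 7 §2 Prop. 7.3;
[Lan2013PELCompactifications] K.-W. Lan, *Arithmetic compactifications of PEL-type Shimura varieties* (2013), §1.3.6 Def. 1.3.6.2, Lemma 1.3.6.5, Cor. 1.3.6.7 (pp. 80–82);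
[Lang1983AbelianVarieties] S. Lang, *Abelian Varieties* (1983), Ch. VII §2 Prop. 3, Prop. 4; [MumfordAV1970] D. Mumford, *Abelian Varieties* (1970), §20 pp. 183–186, §23 p. 231–233;
[Milne2005ShimuraVarieties] J. S. Milne, *Introduction to Shimura varieties* (2005), §6 Thm. 6.11 p. 74 and p. 75.
HC_CM is proved only modulo the printed citations (2 remaining named inputs hLiu418 24832, h413 24833) until rung 0 closes — count-neutral.
-/

set_option autoImplicit false

noncomputable section

universe u

open CategoryTheory AlgebraicGeometry Matrix NumberField IsDedekindDomain
open Literature.AlgebraicGeometry.Motives (AbelianVariety AlgPoints CartierDivisor)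
open Literature.AlgebraicGeometry.AbelianSchemes (AbelianSchemeOver)

/-! ### §0 Lang VII §2 Prop. 4 over an algebraically closed field, and its converse -/

namespace Literature.AlgebraicGeometry.Motives.AbelianVariety

variable {L : Type u} [Field L] [IsAlgClosed L] (A : AbelianVariety L)

/-- **Lang VII §2 Prop. 4 over `Ω = Ω̄`: if `ē^Θ_N(P, Q) = 1` for every `P ∈ A[N](Ω)` then `Q ∈ K(Θ)`** (`(N : Ω) ≠ 0`; the Kummer hypotheses of ★
`weilDiv_linEquiv_zero_of_forall_weilPairingLevel_eq_one` — `[N]` an isogeny, flat, `#A[N](Ω) = N^{2g} = [K(A) : [N]^♯K(A)]` — discharged as in ★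
`weilPairingLevel_eq_one_of_forall_left_of_coprime`). [cite: Lang1983AbelianVarieties, Ch. VII §2 Prop. 4] [cite: MumfordAV1970, §20 (pp. 183–186)] -/
theorem mem_KTheta_of_forall_weilPairingLevel_eq_one {N : ℕ} (hNL : (N : L) ≠ 0) [IsDominant (Hom.toSchemeHom ((N : ℤ) • 𝟙 A))]
    (Θ : CartierDivisor A.X.left) (Q : A.torsionPoints L N) (h : ∀ P : A.torsionPoints L N, A.weilPairingLevel Θ P Q = 1) :
    (Q : A.Points L) ∈ A.KTheta Θ := by
  have hN0 : N ≠ 0 := by rintro rfl; exact hNL Nat.cast_zero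
  have hNZ : ((N : ℕ) : ℤ) ≠ 0 := Int.natCast_ne_zero.mpr hN0
  have hNL' : (((N : ℕ) : ℤ) : L) ≠ 0 := by rw [Int.cast_natCast]; exact hNL
  have hiso : IsIsogeny (((N : ℕ) : ℤ) • 𝟙 A) := isIsogeny_zsmul_id_holds A _ hNZ
  haveI : Surjective (Hom.toSchemeHom (((N : ℕ) : ℤ) • 𝟙 A)) := hiso.1
  haveI : IsFinite (Hom.toSchemeHom (((N : ℕ) : ℤ) • 𝟙 A)) := hiso.2
  haveI : Flat (Hom.toSchemeHom (((N : ℕ) : ℤ) • 𝟙 A)) := IsIsogeny.flat_toSchemeHom_holds hiso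
  have hcard : Nat.card (A.torsionPoints L ((N : ℕ) : ℤ)) = (((N : ℕ)) : ℤ).natAbs ^ (2 * A.dim) :=
    natCard_torsionPoints_eq_of_isAlgClosed A L _ hNL'
  haveI : Finite (A.torsionPoints L ((N : ℕ) : ℤ)) :=
    Nat.finite_of_card_ne_zero (by
      rw [hcard, Int.natAbs_natCast]
      exact pow_ne_zero _ hN0)
  have hdeg : Module.finrank A.X.left.functionField (FunctionFieldOver (Hom.toSchemeHom (((N : ℕ) : ℤ) • 𝟙 A))) =
      Nat.card (A.torsionPoints L ((N : ℕ) : ℤ)) := by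
    rw [← hiso.kerRank_eq_finrank_functionFieldOver, kerRank_zsmul_id_holds A _ hNZ, hcard]
  exact (A.mem_KTheta_iff Θ _).2 (weilDiv_linEquiv_zero_of_forall_weilPairingLevel_eq_one (Nat.pos_of_ne_zero hN0) hdeg Θ Q h)

omit [IsAlgClosed L] in
/-- **Converse: `Q ∈ K(Θ) ∩ A[N]` pairs trivially with all of `A[N]`** — `D_Q ∼ 0`, so `ē^Θ_N(P, Q) = e_N(P, D_Q) = 1` (Lang VII §2 Prop. 3, ★
`kummerConst_eq_one_of_linEquiv_zero`). [cite: Lang1983AbelianVarieties, Ch. VII §2 Prop. 3] -/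
theorem weilPairingLevel_eq_one_of_mem_KTheta {N : ℕ} [IsDominant (Hom.toSchemeHom ((N : ℤ) • 𝟙 A))]
    (Θ : CartierDivisor A.X.left) (P Q : A.torsionPoints L N) (hQ : (Q : A.Points L) ∈ A.KTheta Θ) :
    A.weilPairingLevel Θ P Q = 1 := by
  rw [weilPairingLevel_eq_kummerConst (A.isTrivializer_weilFn Θ Q) P]
  exact kummerConst_eq_one_of_linEquiv_zero _ ((A.mem_KTheta_iff Θ _).1 hQ) P

end Literature.AlgebraicGeometry.Motives.AbelianVariety

/-! ### §1 Finite groups: the radical of `E_δ` mod `M` is `(∏ ℤ∕δᵢ)²` -/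

namespace Literature.AlgebraicGeometry.AbelianSchemes.TypeKernel

open Literature.AlgebraicGeometry.ModuliOfAbelianVarieties (typeForm IsPolarizationType)
open Literature.AlgebraicGeometry.AbelianSchemes.AbelianSchemeOver (typeFormMod)

variable {g : ℕ}

/-- Row `inl i` of `E_δ` mod `M` applied to `y`: `Σⱼ (E_δ)_{inl i, j} yⱼ = δᵢ · y_{inr i}`. [cite: GenestierNgo2020, §1.2 (symplectic basis of type D)] -/
theorem sum_typeForm_inl_mul (δ : Fin g → ℕ) (M : ℕ) (y : Fin g ⊕ Fin g → ZMod M) (i : Fin g) :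
    ∑ j, ((typeForm δ (Sum.inl i) j : ℤ) : ZMod M) * y j = ((δ i : ℕ) : ZMod M) * y (Sum.inr i) := by
  rw [Fintype.sum_sum_type]
  simp only [typeForm, Matrix.fromBlocks_apply₁₁, Matrix.fromBlocks_apply₁₂, Matrix.zero_apply, Int.cast_zero, zero_mul,
    Finset.sum_const_zero, zero_add, Matrix.diagonal_apply]
  rw [Finset.sum_eq_single i]
  · simp
  · intro j _ hj; simp [Ne.symm hj]
  · intro hi; exact absurd (Finset.mem_univ i) hi

/-- Row `inr i` of `E_δ` mod `M` applied to `y`: `Σⱼ (E_δ)_{inr i, j} yⱼ = -δᵢ · y_{inl i}`. [cite: GenestierNgo2020, §1.2 (symplectic basis of type D)] -/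
theorem sum_typeForm_inr_mul (δ : Fin g → ℕ) (M : ℕ) (y : Fin g ⊕ Fin g → ZMod M) (i : Fin g) :
    ∑ j, ((typeForm δ (Sum.inr i) j : ℤ) : ZMod M) * y j = -(((δ i : ℕ) : ZMod M) * y (Sum.inl i)) := by
  rw [Fintype.sum_sum_type]
  simp only [typeForm, Matrix.fromBlocks_apply₂₁, Matrix.fromBlocks_apply₂₂, Matrix.zero_apply, Int.cast_zero, zero_mul,
    Finset.sum_const_zero, add_zero, Matrix.neg_apply, Matrix.diagonal_apply]
  rw [Finset.sum_eq_single i]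
  · simp
  · intro j _ hj; simp [Ne.symm hj]
  · intro hi; exact absurd (Finset.mem_univ i) hi

/-- `E_δ(x, y) = Σᵢ xᵢ · (E_δ y)ᵢ`. [cite: GenestierNgo2020, §1.3 (1.3.1)] -/
theorem typeFormMod_eq_sum (δ : Fin g → ℕ) (M : ℕ) (x y : Fin g ⊕ Fin g → ZMod M) :
    typeFormMod δ M x y = ∑ i, x i * ∑ j, ((typeForm δ i j : ℤ) : ZMod M) * y j := by
  rw [AbelianSchemeOver.typeFormMod_apply]
  refine Finset.sum_congr rfl fun i _ => ?_
  rw [Finset.mul_sum]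
  refine Finset.sum_congr rfl fun j _ => ?_
  ring

/-- **THE RADICAL OF `E_δ` MOD `M`**: `∀ x, E_δ(x, y) = 0 ↔ ∀ i, δᵢ·y_{inl i} = 0 ∧ δᵢ·y_{inr i} = 0` (test against the basis vectors).
[cite: GenestierNgo2020, §1.2 (symplectic basis of type D)] [cite: Lan2013PELCompactifications, §1.3.6 Def. 1.3.6.1 (pp. 79–80)] -/
theorem forall_typeFormMod_eq_zero_iff (δ : Fin g → ℕ) (M : ℕ) (y : Fin g ⊕ Fin g → ZMod M) :
    (∀ x, typeFormMod δ M x y = 0) ↔ ∀ i, ((δ i : ℕ) : ZMod M) * y (Sum.inl i) = 0 ∧ ((δ i : ℕ) : ZMod M) * y (Sum.inr i) = 0 := by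
  classical
  constructor
  · intro h i
    have h1 := h (Pi.single (Sum.inr i) 1)
    have h2 := h (Pi.single (Sum.inl i) 1)
    rw [typeFormMod_eq_sum, Finset.sum_eq_single (Sum.inr i) (fun j _ hj => by rw [Pi.single_eq_of_ne hj, zero_mul])
      (fun hi => absurd (Finset.mem_univ _) hi), Pi.single_eq_same, one_mul, sum_typeForm_inr_mul, neg_eq_zero] at h1
    rw [typeFormMod_eq_sum, Finset.sum_eq_single (Sum.inl i) (fun j _ hj => by rw [Pi.single_eq_of_ne hj, zero_mul])
      (fun hi => absurd (Finset.mem_univ _) hi), Pi.single_eq_same, one_mul, sum_typeForm_inl_mul] at h2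
    exact ⟨h1, h2⟩
  · intro h x
    rw [typeFormMod_eq_sum, Fintype.sum_sum_type]
    simp only [sum_typeForm_inl_mul, sum_typeForm_inr_mul, (h _).1, (h _).2, neg_zero, mul_zero, Finset.sum_const_zero, add_zero]

/-- The inflation `ℤ∕d → ℤ∕M`, `a ↦ (M∕d)·a` (`d ∣ M`, `M ≠ 0`), is an injective homomorphism onto `{y | d·y = 0}` — stated as an existence (no definition).
[cite: MumfordFogartyKirwan1994, App. 7A (pp. 234–235)] -/
theorem exists_addMonoidHom_zmod_inflate {d M : ℕ} (hM : M ≠ 0) (hd : d ∣ M) :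
    ∃ f : ZMod d →+ ZMod M, Function.Injective f ∧ Set.range f = {y | ((d : ℕ) : ZMod M) * y = 0} := by
  obtain ⟨q, hq⟩ := hd
  have hq0 : q ≠ 0 := by rintro rfl; exact hM (by rw [hq, mul_zero])
  have hd0 : d ≠ 0 := by rintro rfl; exact hM (by rw [hq, zero_mul])
  haveI : NeZero M := ⟨hM⟩
  haveI : NeZero d := ⟨hd0⟩
  -- the lift of `k ↦ q·k`
  let f0 : ℤ →+ ZMod M := (AddMonoidHom.mulLeft ((q : ℕ) : ZMod M)).comp (Int.castAddHom (ZMod M))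
  have hf0 : f0 (d : ℤ) = 0 := by
    show ((q : ℕ) : ZMod M) * (((d : ℕ) : ℤ) : ZMod M) = 0
    rw [Int.cast_natCast, ← Nat.cast_mul, mul_comm, ← hq, ZMod.natCast_self]
  let f : ZMod d →+ ZMod M := ZMod.lift d ⟨f0, hf0⟩
  have hf : ∀ k : ℤ, f (k : ZMod d) = ((q : ℕ) : ZMod M) * (k : ZMod M) := fun k => ZMod.lift_coe d ⟨f0, hf0⟩ k
  have hfn : ∀ n : ℕ, f (n : ZMod d) = ((q * n : ℕ) : ZMod M) := fun n => by
    have := hf n; rwa [Int.cast_natCast, Int.cast_natCast, ← Nat.cast_mul] at this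
  refine ⟨f, ?_, ?_⟩
  · -- injective: `q·a ≡ 0 (M) ⇒ d ∣ a`
    intro a b hab
    rw [← sub_eq_zero] at hab ⊢
    rw [← map_sub] at hab
    set c := a - b
    rw [← ZMod.natCast_zmod_val c, hfn, ZMod.natCast_eq_zero_iff] at hab
    rw [← ZMod.natCast_zmod_val c, ZMod.natCast_eq_zero_iff]
    rw [hq, mul_comm d q] at hab
    exact Nat.dvd_of_mul_dvd_mul_left (Nat.pos_of_ne_zero hq0) hab
  · ext y
    simp only [Set.mem_range, Set.mem_setOf_eq]
    constructor
    · rintro ⟨a, rfl⟩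
      rw [← ZMod.natCast_zmod_val a, hfn, ← Nat.cast_mul, ZMod.natCast_eq_zero_iff, hq]
      exact ⟨a.val, by ring⟩
    · intro hy
      rw [← ZMod.natCast_zmod_val y, ← Nat.cast_mul, ZMod.natCast_eq_zero_iff] at hy
      have hdq : d * q ∣ M := by rw [hq]
      obtain ⟨t, ht⟩ := Nat.dvd_of_mul_dvd_mul_left (Nat.pos_of_ne_zero hd0) (hdq.trans hy)
      exact ⟨(t : ZMod d), by rw [hfn, ← ht, ZMod.natCast_zmod_val]⟩

/-- **`(∏ ℤ∕δᵢ)² ≅ rad_M(E_δ)`**: for `δ` a polarisation type with `δᵢ ∣ M` (`M ≠ 0`) there is an injective homomorphism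
`(∏ ℤ∕δᵢ) × (∏ ℤ∕δᵢ) ↪ (ℤ∕M)^{2g}` (coordinatewise inflation `(a, b) ↦ ((M∕δᵢ)aᵢ, (M∕δᵢ)bᵢ)`) whose image is the radical `{y | ∀ x, E_δ(x,y) = 0}` of `E_δ` mod `M`
— the level-`M` shadow of «`ker λ ≅ ∏ ℤ∕δᵢ × ∏ μ_{δᵢ}`». [cite: MumfordFogartyKirwan1994, App. 7A (pp. 234–235)] [cite: Lan2013PELCompactifications, §1.3.6 Def. 1.3.6.1 (pp. 79–80)] -/
theorem exists_mulHom_range_eq_typeFormMod_radical {δ : Fin g → ℕ} {M : ℕ} (hM : M ≠ 0) (hdiv : ∀ i, δ i ∣ M) :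
    ∃ ψ : Multiplicative (((i : Fin g) → ZMod (δ i)) × ((i : Fin g) → ZMod (δ i))) →* Multiplicative (Fin g ⊕ Fin g → ZMod M),
      Function.Injective ψ ∧ Set.range ψ = {y | ∀ x, typeFormMod δ M x (Multiplicative.toAdd y) = 0} := by
  classical
  choose f hfinj hfrange using fun i => exists_addMonoidHom_zmod_inflate (d := δ i) hM (hdiv i)
  -- the additive map `(a, b) ↦ Sum.elim (fᵢ aᵢ) (fᵢ bᵢ)`
  let F : (((i : Fin g) → ZMod (δ i)) × ((i : Fin g) → ZMod (δ i))) →+ (Fin g ⊕ Fin g → ZMod M) :=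
    { toFun := fun p => Sum.elim (fun i => f i (p.1 i)) (fun i => f i (p.2 i))
      map_zero' := by
        funext j; rcases j with i | i <;> simp
      map_add' := fun p p' => by
        funext j; rcases j with i | i <;> simp }
  have hF : ∀ p j, F p j = Sum.elim (fun i => f i (p.1 i)) (fun i => f i (p.2 i)) j := fun _ _ => rfl
  refine ⟨AddMonoidHom.toMultiplicative F, ?_, ?_⟩
  · -- injective
    intro p p' h
    have h' : F (Multiplicative.toAdd p) = F (Multiplicative.toAdd p') := congrArg Multiplicative.toAdd h
    have h1 : (Multiplicative.toAdd p).1 = (Multiplicative.toAdd p').1 := by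
      funext i; exact hfinj i (by simpa [hF] using congrFun h' (Sum.inl i))
    have h2 : (Multiplicative.toAdd p).2 = (Multiplicative.toAdd p').2 := by
      funext i; exact hfinj i (by simpa [hF] using congrFun h' (Sum.inr i))
    exact congrArg Multiplicative.ofAdd (Prod.ext h1 h2)
  · ext y
    simp only [Set.mem_range, Set.mem_setOf_eq, forall_typeFormMod_eq_zero_iff]
    constructor
    · rintro ⟨p, rfl⟩ i
      have h1 : f i ((Multiplicative.toAdd p).1 i) ∈ Set.range (f i) := ⟨_, rfl⟩
      have h2 : f i ((Multiplicative.toAdd p).2 i) ∈ Set.range (f i) := ⟨_, rfl⟩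
      rw [hfrange i] at h1 h2
      exact ⟨h1, h2⟩
    · intro hy
      have h1 : ∀ i, ∃ a : ZMod (δ i), f i a = Multiplicative.toAdd y (Sum.inl i) := fun i => by
        have : Multiplicative.toAdd y (Sum.inl i) ∈ Set.range (f i) := by rw [hfrange i]; exact (hy i).1
        exact this
      have h2 : ∀ i, ∃ b : ZMod (δ i), f i b = Multiplicative.toAdd y (Sum.inr i) := fun i => by
        have : Multiplicative.toAdd y (Sum.inr i) ∈ Set.range (f i) := by rw [hfrange i]; exact (hy i).2
        exact this
      choose a ha using h1
      choose b hb using h2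
      refine ⟨Multiplicative.ofAdd (a, b), ?_⟩
      apply congrArg Multiplicative.ofAdd
      funext j; rcases j with i | i
      · exact ha i
      · exact hb i

end Literature.AlgebraicGeometry.AbelianSchemes.TypeKernel

/-! ### §2 The `δ`-clause at ONE geometric point from a symplectic lift -/

namespace Literature.AlgebraicGeometry.AbelianSchemes.AbelianSchemeOver

open Literature.AlgebraicGeometry.ModuliOfAbelianVarieties (IsPolarizationType)
open Literature.AlgebraicGeometry.Motives

variable {S : Scheme.{u}} {A : AbelianSchemeOver S} {D : A.DualPair} (pol : A.Polarization D)

/-- **THE `δ`-CLAUSE OF `HasType` AT A GEOMETRIC POINT FROM A SYMPLECTIC LIFT.**  `Ω` algebraically closed of characteristic `0`, `λ̄_s = Λ(𝒪(Θ))` (`hlam`),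
`Λ` a symplectic lift of a level-`N` structure (`N ≠ 0`) for `(Θ, δ)`, `δ` a polarisation type: the kernel `ker λ̄_s(Ω)` is the image of an injective homomorphism
from `(∏ ℤ∕δᵢ)²` — at the level `M := N·#K(Θ)·∏δᵢ`, `K(Θ) = lift_M(rad_M(E_δ))` by Lang VII §2 Prop. 4 and its converse, and `rad_M(E_δ) ≅ (∏ ℤ∕δᵢ)²` (§1).
[cite: MumfordFogartyKirwan1994, App. 7A (pp. 234–235)] [cite: Lan2013PELCompactifications, §1.3.6 Lemma 1.3.6.5 (p. 81)] [cite: Lang1983AbelianVarieties, Ch. VII §2 Prop. 4]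
[cite: MumfordAV1970, §23 (pp. 231–233)] -/
theorem Polarization.exists_mulHom_range_eq_kerPointsAt_of_symplecticLift {g N : ℕ} (φ : A.LevelStructure g N) (hN : N ≠ 0)
    {δ : Fin g → ℕ} (hδ : IsPolarizationType δ) {Ω : Type u} [Field Ω] [IsAlgClosed Ω] [CharZero Ω] (s : Spec (.of Ω) ⟶ S)
    {Θ : CartierDivisor (A.fibre s).toAbelianVariety.X.left} (hlam : A.IsLambdaOfAt s D pol.lam Θ) (Λ : φ.SymplecticLift s Θ δ) :
    ∃ ψ : Multiplicative (((i : Fin g) → ZMod (δ i)) × ((i : Fin g) → ZMod (δ i))) →* (A.fibre s).toAbelianVariety.Points Ω,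
      Function.Injective ψ ∧ Set.range ψ = pol.kerPointsAt s := by
  classical
  -- `ker λ̄_s = K(Θ)`, finite, of exponent `k`
  have hK : ∀ P : (A.fibre s).toAbelianVariety.Points Ω, P ∈ pol.kerPointsAt s ↔ P ∈ (A.fibre s).toAbelianVariety.KTheta Θ := fun P => pol.mem_kerPointsAt_iff_mem_KTheta s hlam P
  have hKset : ((A.fibre s).toAbelianVariety.KTheta Θ : Set ((A.fibre s).toAbelianVariety.Points Ω)) = pol.kerPointsAt s := Set.ext fun P => (hK P).symm
  haveI hfin : Finite ((A.fibre s).toAbelianVariety.KTheta Θ) := by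
    have h : ((A.fibre s).toAbelianVariety.KTheta Θ : Set ((A.fibre s).toAbelianVariety.Points Ω)).Finite := by rw [hKset]; exact pol.finite_kerPointsAt s
    exact h.to_subtype
  set k := Nat.card ((A.fibre s).toAbelianVariety.KTheta Θ) with hk
  have hk0 : k ≠ 0 := Nat.card_pos.ne'
  -- the level `M := N · k · ∏ δᵢ`
  set M := N * (k * ∏ i, δ i) with hMdef
  have hprod0 : (∏ i, δ i) ≠ 0 := Finset.prod_ne_zero_iff.2 fun i _ => (hδ.1 i).ne'
  have hM0 : M ≠ 0 := mul_ne_zero hN (mul_ne_zero hk0 hprod0)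
  haveI : NeZero M := ⟨hM0⟩
  have hNM : N ∣ M := Dvd.intro _ rfl
  have hkM : k ∣ M := ⟨N * ∏ i, δ i, by rw [hMdef]; ring⟩
  have hdivδ : ∀ i, δ i ∣ M := fun i =>
    (Finset.dvd_prod_of_mem δ (Finset.mem_univ i)).trans ⟨N * k, by rw [hMdef]; ring⟩
  have hMΩ : (M : Ω) ≠ 0 := Nat.cast_ne_zero.2 hM0
  haveI := AbelianVariety.isDominant_toSchemeHom_zsmul_of_ne_zero (A.fibre s).toAbelianVariety hMΩ
  -- the lift at level `M`
  have hbij := Λ.lift_bijective hNM hM0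
  have hζ := Λ.isPrimitiveRoot_ζ hNM hM0
  have hpair := Λ.pairing hNM hMΩ
  -- `Q ∈ K(Θ)` is `M`-torsion
  have htor : ∀ Q : (A.fibre s).toAbelianVariety.Points Ω, Q ∈ (A.fibre s).toAbelianVariety.KTheta Θ → Q ∈ (A.fibre s).toAbelianVariety.torsionPoints Ω (M : ℤ) := fun Q hQ => by
    rw [AbelianVariety.mem_torsionPoints_iff, zpow_natCast]
    obtain ⟨t, ht⟩ := hkM
    rw [ht, pow_mul, (A.fibre s).toAbelianVariety.pow_natCard_KTheta_eq_one hQ, one_pow]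
  -- the key equivalence on `(ℤ/M)^{2g}`
  have hkey : ∀ y : Fin g ⊕ Fin g → ZMod M,
      ((Λ.lift M (Multiplicative.ofAdd y) : (A.fibre s).toAbelianVariety.torsionPoints Ω (M : ℤ)) : (A.fibre s).toAbelianVariety.Points Ω) ∈ (A.fibre s).toAbelianVariety.KTheta Θ ↔
        ∀ x, typeFormMod δ M x y = 0 := by
    intro y
    constructor
    · intro hy x
      have h1 : (A.fibre s).toAbelianVariety.weilPairingLevel Θ (Λ.lift M (Multiplicative.ofAdd x)) (Λ.lift M (Multiplicative.ofAdd y)) = 1 :=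
        (A.fibre s).toAbelianVariety.weilPairingLevel_eq_one_of_mem_KTheta Θ _ _ hy
      rw [hpair] at h1
      have h2 : M ∣ (typeFormMod δ M x y).val := (hζ.pow_eq_one_iff_dvd _).1 h1
      have h3 : (typeFormMod δ M x y).val = 0 := Nat.eq_zero_of_dvd_of_lt h2 (ZMod.val_lt _)
      exact (ZMod.val_eq_zero _).1 h3
    · intro hy
      refine (A.fibre s).toAbelianVariety.mem_KTheta_of_forall_weilPairingLevel_eq_one hMΩ Θ _ fun P => ?_
      obtain ⟨x', rfl⟩ := hbij.2 P
      rw [← ofAdd_toAdd x', hpair, hy, ZMod.val_zero, pow_zero]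
  -- §1: the radical is `(∏ ℤ/δᵢ)²`
  obtain ⟨ψ₀, hψ₀, hrange₀⟩ := TypeKernel.exists_mulHom_range_eq_typeFormMod_radical (δ := δ) hM0 hdivδ
  refine ⟨((A.fibre s).toAbelianVariety.torsionPoints Ω (M : ℤ)).subtype.comp ((Λ.lift M).comp ψ₀), ?_, ?_⟩
  · exact Subtype.val_injective.comp (hbij.1.comp hψ₀)
  · ext P
    simp only [MonoidHom.coe_comp, Subgroup.coe_subtype, Set.mem_range, Function.comp_apply]
    constructor
    · rintro ⟨t, rfl⟩
      rw [hK]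
      have ht : ψ₀ t ∈ Set.range ψ₀ := ⟨t, rfl⟩
      rw [hrange₀] at ht
      have := (hkey (Multiplicative.toAdd (ψ₀ t))).2 ht
      rwa [ofAdd_toAdd] at this
    · intro hP
      rw [hK] at hP
      obtain ⟨y, hy⟩ := hbij.2 ⟨P, htor P hP⟩
      have hyK : ((Λ.lift M (Multiplicative.ofAdd (Multiplicative.toAdd y)) : (A.fibre s).toAbelianVariety.torsionPoints Ω (M : ℤ)) : (A.fibre s).toAbelianVariety.Points Ω) ∈ (A.fibre s).toAbelianVariety.KTheta Θ := by
        rw [ofAdd_toAdd, hy]; exact hP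
      have hyrad : y ∈ Set.range ψ₀ := by
        rw [hrange₀]; exact (hkey _).1 hyK
      obtain ⟨t, rfl⟩ := hyrad
      exact ⟨t, by rw [hy]⟩

/-! ### §3 THE HEADS -/

/-- **`HasType δ` FROM A SYMPLECTIC LIFT AT ONE GEOMETRIC POINT** over a preconnected base on which every positive integer is invertible (the `δ`-clause at `s₀` by
§2, everywhere by the local constancy of the type ★ `hasType_of_exists_mulHom_at`). [cite: MumfordFogartyKirwan1994, App. 7A (pp. 234–235)]
[cite: Lan2013PELCompactifications, §1.3.6 Lemma 1.3.6.5 and Cor. 1.3.6.7 (pp. 81–82)] -/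
theorem Polarization.hasType_of_symplecticLift [PreconnectedSpace S] (hchar : ∀ (s : S) (m : ℕ), 0 < m → (m : S.residueField s) ≠ 0)
    {g N : ℕ} (φ : A.LevelStructure g N) (hN : N ≠ 0) {δ : Fin g → ℕ} (hδ : IsPolarizationType δ)
    {Ω : Type u} [Field Ω] [IsAlgClosed Ω] [CharZero Ω] (s₀ : Spec (.of Ω) ⟶ S)
    {Θ : CartierDivisor (A.fibre s₀).toAbelianVariety.X.left} (hlam : A.IsLambdaOfAt s₀ D pol.lam Θ) (Λ : φ.SymplecticLift s₀ Θ δ) :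
    pol.HasType δ :=
  pol.hasType_of_exists_mulHom_at hchar hδ s₀ (pol.exists_mulHom_range_eq_kerPointsAt_of_symplecticLift φ hN hδ s₀ hlam Λ)

end Literature.AlgebraicGeometry.AbelianSchemes.AbelianSchemeOver

end
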